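import Summits.NavierStokesRegularity.TurbBounds.ShearSpecQForms
import HarnessLib

/-!
# The boundary projection of SPEC 2.8 as an identity of quadratic forms

Cell `turb-bounds` (pub-turb), shear lane, pub-turb-shear gen 6 (2026-08-22); v2 lane. `Q_m = blkdiag(A,A)ᵀ M blkdiag(A,A)` with `c = Aω`
(`c_0 = ω_0/3`, `c_i = ω_{i−1}`, `i = 1 … L2−1`). With `n = L2 − 1` and `dim = 2n`:
* `pcoef L2 r i` — the entries of `blkdiag(A,A)` (row `r < 2L2`, column `i < 2n`), written WITHOUT division (two blocks);
* `sum_projCol` — a `projCol` sum is the `pcoef`-weighted sum over all rows `r < 2L2`;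
* `projEntry_eq_sum` — `projEntry Mf L2 i j = Σ_{r,s<2L2} P_{ri}·P_{sj}·Mf r s`;
* `qform_projTab` — **`ωᵀ (projTab Mf L2) ω = Σ_{r,s<2L2} (Pω)_r · Mf r s · (Pω)_s`** with `(Pω)_r = Σ_{i<2n} P_{ri} ω_i` (`projLin`);
* `projLin_eq` — `(Pω)_r` written out: `ω_0/3, ω_0, ω_1, …, ω_{n−1} ; ω_n/3, ω_n, …, ω_{2n−1}` (the stacked `(Aω¹; Aω²)`).
PURE FINSET ALGEBRA. HONEST FRAMING: rigorous bounds for the stated PDE and boundary conditions; no claim about physical turbulence beyond the bound.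
-/

set_option linter.style.longLine false

namespace Summit.NavierStokesRegularity.TurbBounds.ShearSpecPieces

open Finset

/-- Entry `(r, i)` of `blkdiag(A, A)` (`A : L2 × (L2−1)`; block 0 = columns `i < L2−1`, rows `r < L2`; block 1 = the rest):
in block `b` with `q = i − b(L2−1)`, row `bL2 + q + 1` carries `1` and, if `q = 0`, row `bL2` carries `1/3`. -/
def pcoef (L2 r i : ℕ) : ℚ :=
  if i < L2 - 1 then (if r = i + 1 then 1 else if i = 0 ∧ r = 0 then 1 / 3 else 0)
  else (if r = L2 + (i - (L2 - 1)) + 1 then 1 else if i = L2 - 1 ∧ r = L2 then 1 / 3 else 0)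

/-- `projCol` in the two-block form (no division): for `i < L2−1` it is built at offset `0` with `q = i`, else at offset `L2` with `q = i − (L2−1)`. -/
theorem projCol_eq (L2 i : ℕ) (_hL : 2 ≤ L2) (hi : i < 2 * (L2 - 1)) :
    projCol L2 i = if i < L2 - 1 then (if i = 0 then [(1, 1), (0, 1 / 3)] else [(i + 1, 1)])
      else (if i - (L2 - 1) = 0 then [(L2 + 1, 1), (L2, 1 / 3)] else [(L2 + (i - (L2 - 1)) + 1, 1)]) := by
  have hn : 0 < L2 - 1 := by omega
  unfold projCol
  by_cases h : i < L2 - 1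
  · have hd : i / (L2 - 1) = 0 := Nat.div_eq_of_lt h
    have hm : i % (L2 - 1) = i := Nat.mod_eq_of_lt h
    simp only [hd, hm, zero_mul, zero_add, if_pos h]
  · have h' : L2 - 1 ≤ i := not_lt.mp h
    have hd : i / (L2 - 1) = 1 := Nat.div_eq_of_lt_le (by omega) (by omega)
    have hm : i % (L2 - 1) = i - (L2 - 1) := by
      rw [Nat.mod_eq_sub_mod h', Nat.mod_eq_of_lt (by omega)]
    simp only [hd, hm, one_mul, if_neg h]

/-- **A `projCol` sum is the `pcoef`-weighted sum over the rows** (`i < 2(L2−1)`, `2 ≤ L2`). -/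
theorem sum_projCol (L2 i : ℕ) (hL : 2 ≤ L2) (hi : i < 2 * (L2 - 1)) (f : ℕ → ℚ) :
    ((projCol L2 i).map fun rc => rc.2 * f rc.1).sum = ∑ r ∈ range (2 * L2), pcoef L2 r i * f r := by
  rw [projCol_eq L2 i hL hi]
  unfold pcoef
  by_cases h : i < L2 - 1
  · simp only [if_pos h]
    by_cases h0 : i = 0
    · subst h0
      simp only [if_true, List.map_cons, List.map_nil, List.sum_cons, List.sum_nil, add_zero]
      rw [Finset.sum_eq_add_of_mem 1 0 (by simp; omega) (by simp; omega) (by omega)]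
      · simp
      · intro r _ h12; simp [h12.1, h12.2]
    · simp only [if_neg h0, List.map_cons, List.map_nil, List.sum_cons, List.sum_nil, add_zero]
      rw [Finset.sum_eq_single (i + 1)]
      · simp
      · intro r _ hr; simp [hr, h0]
      · intro hr; exact absurd (by simp; omega) hr
  · simp only [if_neg h]
    by_cases h0 : i - (L2 - 1) = 0
    · have hi' : i = L2 - 1 := by omega
      simp only [h0, if_true, List.map_cons, List.map_nil, List.sum_cons, List.sum_nil, add_zero]
      rw [Finset.sum_eq_add_of_mem (L2 + 1) L2 (by simp; omega) (by simp; omega) (by omega)]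
      · simp [hi']
      · intro r _ h12; simp [h12.1, h12.2]
    · have hi' : ¬ i = L2 - 1 := by omega
      simp only [if_neg h0, List.map_cons, List.map_nil, List.sum_cons, List.sum_nil, add_zero]
      rw [Finset.sum_eq_single (L2 + (i - (L2 - 1)) + 1)]
      · simp
      · intro r _ hr; simp [hr, hi']
      · intro hr; exact absurd (by simp; omega) hr

/-- **`projEntry` as a double sum over rows**: `projEntry Mf L2 i j = Σ_{r,s<2L2} P_{ri}·P_{sj}·Mf r s`. -/
theorem projEntry_eq_sum (Mf : ℕ → ℕ → ℚ) (L2 i j : ℕ) (hL : 2 ≤ L2) (hi : i < 2 * (L2 - 1)) (hj : j < 2 * (L2 - 1)) :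
    projEntry Mf L2 i j = ∑ r ∈ range (2 * L2), ∑ s ∈ range (2 * L2), pcoef L2 r i * pcoef L2 s j * Mf r s := by
  rw [projEntry_eq]
  have inner : ∀ rc : ℕ × ℚ, ((projCol L2 j).map fun sd => rc.2 * sd.2 * Mf rc.1 sd.1).sum = rc.2 * ∑ s ∈ range (2 * L2), pcoef L2 s j * Mf rc.1 s := by
    intro rc
    calc ((projCol L2 j).map fun sd => rc.2 * sd.2 * Mf rc.1 sd.1).sum
        = ((projCol L2 j).map fun sd => sd.2 * (rc.2 * Mf rc.1 sd.1)).sum := by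
          congr 1; exact List.map_congr_left fun sd _ => by ring
      _ = ∑ s ∈ range (2 * L2), pcoef L2 s j * (rc.2 * Mf rc.1 s) := sum_projCol L2 j hL hj (fun s => rc.2 * Mf rc.1 s)
      _ = rc.2 * ∑ s ∈ range (2 * L2), pcoef L2 s j * Mf rc.1 s := by
          rw [Finset.mul_sum]; exact Finset.sum_congr rfl fun s _ => by ring
  have h2 := sum_projCol L2 i hL hi (fun r => ∑ s ∈ range (2 * L2), pcoef L2 s j * Mf r s)
  rw [List.map_congr_left fun rc _ => inner rc, h2]
  refine Finset.sum_congr rfl fun r _ => ?_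
  rw [Finset.mul_sum]
  exact Finset.sum_congr rfl fun s _ => by ring

/-- `(Pω)_r = Σ_{i<2(L2−1)} P_{ri} ω_i` — row `r` of the stacked vector `(Aω¹; Aω²)`. -/
def projLin (L2 : ℕ) (ω : ℕ → ℝ) (r : ℕ) : ℝ := ∑ i ∈ range (2 * (L2 - 1)), (pcoef L2 r i : ℝ) * ω i

/-- Four-fold sum swap. -/
theorem sum4_comm (A B : Finset ℕ) (F : ℕ → ℕ → ℕ → ℕ → ℝ) :
    ∑ i ∈ A, ∑ j ∈ A, ∑ r ∈ B, ∑ s ∈ B, F i j r s = ∑ r ∈ B, ∑ s ∈ B, ∑ i ∈ A, ∑ j ∈ A, F i j r s := by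
  calc ∑ i ∈ A, ∑ j ∈ A, ∑ r ∈ B, ∑ s ∈ B, F i j r s
      = ∑ i ∈ A, ∑ r ∈ B, ∑ j ∈ A, ∑ s ∈ B, F i j r s := Finset.sum_congr rfl fun i _ => Finset.sum_comm
    _ = ∑ r ∈ B, ∑ i ∈ A, ∑ j ∈ A, ∑ s ∈ B, F i j r s := Finset.sum_comm
    _ = ∑ r ∈ B, ∑ i ∈ A, ∑ s ∈ B, ∑ j ∈ A, F i j r s :=
        Finset.sum_congr rfl fun r _ => Finset.sum_congr rfl fun i _ => Finset.sum_comm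
    _ = ∑ r ∈ B, ∑ s ∈ B, ∑ i ∈ A, ∑ j ∈ A, F i j r s := Finset.sum_congr rfl fun r _ => Finset.sum_comm

/-- **The projection as an identity of quadratic forms** (`2 ≤ L2`): `ωᵀ (projTab Mf L2) ω = Σ_{r,s<2L2} (Pω)_r·Mf r s·(Pω)_s`. -/
theorem qform_projTab (Mf : ℕ → ℕ → ℚ) (L2 : ℕ) (hL : 2 ≤ L2) (ω : ℕ → ℝ) :
    qform (projTab Mf L2) (2 * (L2 - 1)) ω = ∑ r ∈ range (2 * L2), ∑ s ∈ range (2 * L2), projLin L2 ω r * (Mf r s : ℝ) * projLin L2 ω s := by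
  unfold qform bform projLin
  have hentry : ∀ i ∈ range (2 * (L2 - 1)), ∀ j ∈ range (2 * (L2 - 1)),
      ω i * (get2 (projTab Mf L2) i j : ℝ) * ω j
        = ∑ r ∈ range (2 * L2), ∑ s ∈ range (2 * L2), ω i * ((pcoef L2 r i : ℝ) * (pcoef L2 s j : ℝ) * (Mf r s : ℝ)) * ω j := by
    intro i hi j hj
    have hi' : i < 2 * (L2 - 1) := by simpa using hi
    have hj' : j < 2 * (L2 - 1) := by simpa using hj
    rw [get2_projTab, if_pos ⟨hi', hj'⟩, projEntry_eq_sum Mf L2 i j hL hi' hj']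
    push_cast
    rw [Finset.mul_sum, Finset.sum_mul]
    refine Finset.sum_congr rfl fun r _ => ?_
    rw [Finset.mul_sum, Finset.sum_mul]
  rw [Finset.sum_congr rfl fun i hi => Finset.sum_congr rfl fun j hj => hentry i hi j hj, sum4_comm]
  refine Finset.sum_congr rfl fun r _ => Finset.sum_congr rfl fun s _ => ?_
  rw [show (∑ i ∈ range (2 * (L2 - 1)), (pcoef L2 r i : ℝ) * ω i) * (Mf r s : ℝ) * (∑ i ∈ range (2 * (L2 - 1)), (pcoef L2 s i : ℝ) * ω i)
      = (Mf r s : ℝ) * ((∑ i ∈ range (2 * (L2 - 1)), (pcoef L2 r i : ℝ) * ω i) * (∑ j ∈ range (2 * (L2 - 1)), (pcoef L2 s j : ℝ) * ω j)) by ring,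
    Finset.sum_mul_sum]
  simp only [Finset.mul_sum]
  exact Finset.sum_congr rfl fun i _ => Finset.sum_congr rfl fun j _ => by ring

/-- **`(Pω)_r` written out** (`r < 2L2`, `2 ≤ L2`): `ω_0/3` at `r = 0`, `ω_{r−1}` for `1 ≤ r ≤ L2−1`, `ω_{L2−1}/3` at `r = L2`,
`ω_{r−2}` for `L2+1 ≤ r ≤ 2L2−1`. -/
theorem projLin_eq (L2 : ℕ) (hL : 2 ≤ L2) (ω : ℕ → ℝ) (r : ℕ) (hr : r < 2 * L2) :
    projLin L2 ω r = if r = 0 then ω 0 / 3 else if r < L2 then ω (r - 1) else if r = L2 then ω (L2 - 1) / 3 else ω (r - 2) := by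
  unfold projLin pcoef
  by_cases h0 : r = 0
  · subst h0
    rw [if_pos rfl, Finset.sum_eq_single 0]
    · have : (0 : ℕ) < L2 - 1 := by omega
      simp [this]; ring
    · intro i hi hi0
      by_cases h : i < L2 - 1
      · simp [h, hi0]
      · have h4 : ¬ (i = L2 - 1 ∧ (0 : ℕ) = L2) := fun hh => by omega
        simp [h, h4]
    · intro h; exact absurd (by simp; omega) h
  · rw [if_neg h0]
    by_cases h1 : r < L2
    · rw [if_pos h1, Finset.sum_eq_single (r - 1)]
      · have : r - 1 < L2 - 1 := by omega
        have e : r = r - 1 + 1 := by omega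
        simp [this, ← e]
      · intro i hi hir
        by_cases h : i < L2 - 1
        · have : ¬ r = i + 1 := fun h' => hir (by omega)
          simp [h, this, h0]
        · have h3 : ¬ r = L2 + (i - (L2 - 1)) + 1 := by omega
          have h4 : ¬ (i = L2 - 1 ∧ r = L2) := fun hh => by omega
          simp [h, h3, h4]
      · intro h; exact absurd (by simp; omega) h
    · rw [if_neg h1]
      by_cases h2 : r = L2
      · subst h2
        rw [if_pos rfl, Finset.sum_eq_single (r - 1)]
        · simp
          ring
        · intro i hi hir
          by_cases h : i < r - 1
          · have : ¬ r = i + 1 := fun h' => by omega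
            simp [h, this, h0]
          · have h3 : ¬ r = r + (i - (r - 1)) + 1 := fun h' => by omega
            have h4 : ¬ i = r - 1 := hir
            simp [h, h3, h4]
        · intro h; exact absurd (by simp; omega) h
      · rw [if_neg h2, Finset.sum_eq_single (r - 2)]
        · have : ¬ (r - 2 < L2 - 1) := by omega
          have e : L2 + (r - 2 - (L2 - 1)) + 1 = r := by omega
          simp [this, e]
        · intro i hi hir
          by_cases h : i < L2 - 1
          · have : ¬ r = i + 1 := fun h' => by omega
            simp [h, this, h0]
          · have h3 : ¬ r = L2 + (i - (L2 - 1)) + 1 := fun h' => hir (by omega)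
            simp [h, h3, h2]
        · intro h; exact absurd (by simp; omega) h

/-! ### the `2L2 × 2L2` block forms and the three pieces -/

/-- A double sum over `range (2L2)` split into the four `L2 × L2` blocks. -/
theorem sum_sum_two_blocks (L2 : ℕ) (F : ℕ → ℕ → ℝ) :
    ∑ r ∈ range (2 * L2), ∑ s ∈ range (2 * L2), F r s
      = ∑ r ∈ range L2, ∑ s ∈ range L2, F r s + ∑ r ∈ range L2, ∑ s ∈ range L2, F r (L2 + s)
        + (∑ r ∈ range L2, ∑ s ∈ range L2, F (L2 + r) s + ∑ r ∈ range L2, ∑ s ∈ range L2, F (L2 + r) (L2 + s)) := by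
  rw [two_mul, Finset.sum_range_add]
  simp only [Finset.sum_range_add, Finset.sum_add_distrib]

/-- **Form of `[[S,0],[0,S]]`**: `uᵀ (S ⊕ S) u = xᵀSx + yᵀSy` with `x = u|_{<L2}`, `y_s = u_{L2+s}`. -/
theorem form_twoDiag (L2 : ℕ) (S : List (List ℚ)) (u : ℕ → ℝ) :
    ∑ r ∈ range (2 * L2), ∑ s ∈ range (2 * L2), u r * (twoDiag L2 S r s : ℝ) * u s
      = qform S L2 u + qform S L2 (fun s => u (L2 + s)) := by
  rw [sum_sum_two_blocks]
  unfold qform bform twoDiag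
  have h1 : ∀ r ∈ range L2, ∀ s ∈ range L2,
      u r * ((if r < L2 ∧ s < L2 then get2 S r s else if L2 ≤ r ∧ L2 ≤ s then get2 S (r - L2) (s - L2) else 0 : ℚ) : ℝ) * u s
        = u r * (get2 S r s : ℝ) * u s := by
    intro r hr s hs; rw [if_pos ⟨by simpa using hr, by simpa using hs⟩]
  have h2 : ∀ r ∈ range L2, ∀ s ∈ range L2,
      u r * ((if r < L2 ∧ L2 + s < L2 then get2 S r (L2 + s) else if L2 ≤ r ∧ L2 ≤ L2 + s then get2 S (r - L2) (L2 + s - L2) else 0 : ℚ) : ℝ) * u (L2 + s) = 0 := by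
    intro r hr s _
    have hr' : r < L2 := by simpa using hr
    rw [if_neg (fun h => by omega), if_neg (fun h => by omega)]; simp
  have h3 : ∀ r ∈ range L2, ∀ s ∈ range L2,
      u (L2 + r) * ((if L2 + r < L2 ∧ s < L2 then get2 S (L2 + r) s else if L2 ≤ L2 + r ∧ L2 ≤ s then get2 S (L2 + r - L2) (s - L2) else 0 : ℚ) : ℝ) * u s = 0 := by
    intro r _ s hs
    have hs' : s < L2 := by simpa using hs
    rw [if_neg (fun h => by omega), if_neg (fun h => by omega)]; simp
  have h4 : ∀ r ∈ range L2, ∀ s ∈ range L2,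
      u (L2 + r) * ((if L2 + r < L2 ∧ L2 + s < L2 then get2 S (L2 + r) (L2 + s)
        else if L2 ≤ L2 + r ∧ L2 ≤ L2 + s then get2 S (L2 + r - L2) (L2 + s - L2) else 0 : ℚ) : ℝ) * u (L2 + s)
        = u (L2 + r) * (get2 S r s : ℝ) * u (L2 + s) := by
    intro r _ s _
    rw [if_neg (fun h => by omega), if_pos ⟨by omega, by omega⟩, Nat.add_sub_cancel_left, Nat.add_sub_cancel_left]
  rw [Finset.sum_congr rfl fun r hr => Finset.sum_congr rfl fun s hs => h1 r hr s hs,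
    Finset.sum_congr rfl fun r hr => Finset.sum_congr rfl fun s hs => h2 r hr s hs,
    Finset.sum_congr rfl fun r hr => Finset.sum_congr rfl fun s hs => h3 r hr s hs,
    Finset.sum_congr rfl fun r hr => Finset.sum_congr rfl fun s hs => h4 r hr s hs]
  simp

/-- **Form of `[[0,U],[Uᵀ,0]]`, `U = (D/2)(Eᵀ − E)`**: `uᵀ [E]_off u = D·(yᵀEx − xᵀEy)` (`x = u|_{<L2}`, `y_s = u_{L2+s}`) — i.e. `−D·X_fin`
with `X_fin = xᵀ(E − Eᵀ)y` (SPEC 2.5/2.7). -/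
theorem form_twoOff (L2 : ℕ) (D : ℚ) (E : List (List ℚ)) (u : ℕ → ℝ) :
    ∑ r ∈ range (2 * L2), ∑ s ∈ range (2 * L2), u r * (twoOff L2 D E r s : ℝ) * u s
      = (D : ℝ) * (bform E L2 (fun s => u (L2 + s)) u - bform E L2 u (fun s => u (L2 + s))) := by
  rw [sum_sum_two_blocks]
  unfold bform twoOff
  have h1 : ∀ r ∈ range L2, ∀ s ∈ range L2,
      u r * ((if r < L2 ∧ L2 ≤ s then D / 2 * (get2 E (s - L2) r - get2 E r (s - L2))
        else if L2 ≤ r ∧ s < L2 then D / 2 * (get2 E (r - L2) s - get2 E s (r - L2)) else 0 : ℚ) : ℝ) * u s = 0 := by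
    intro r hr s hs
    have hr' : r < L2 := by simpa using hr
    have hs' : s < L2 := by simpa using hs
    rw [if_neg (fun h => by omega), if_neg (fun h => by omega)]; simp
  have h2 : ∀ r ∈ range L2, ∀ s ∈ range L2,
      u r * ((if r < L2 ∧ L2 ≤ L2 + s then D / 2 * (get2 E (L2 + s - L2) r - get2 E r (L2 + s - L2))
        else if L2 ≤ r ∧ L2 + s < L2 then D / 2 * (get2 E (r - L2) (L2 + s) - get2 E (L2 + s) (r - L2)) else 0 : ℚ) : ℝ) * u (L2 + s)
        = (D : ℝ) / 2 * (u r * (get2 E s r : ℝ) * u (L2 + s)) - (D : ℝ) / 2 * (u r * (get2 E r s : ℝ) * u (L2 + s)) := by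
    intro r hr s _
    have hr' : r < L2 := by simpa using hr
    rw [if_pos ⟨hr', by omega⟩, Nat.add_sub_cancel_left]; push_cast; ring
  have h3 : ∀ r ∈ range L2, ∀ s ∈ range L2,
      u (L2 + r) * ((if L2 + r < L2 ∧ L2 ≤ s then D / 2 * (get2 E (s - L2) (L2 + r) - get2 E (L2 + r) (s - L2))
        else if L2 ≤ L2 + r ∧ s < L2 then D / 2 * (get2 E (L2 + r - L2) s - get2 E s (L2 + r - L2)) else 0 : ℚ) : ℝ) * u s
        = (D : ℝ) / 2 * (u (L2 + r) * (get2 E r s : ℝ) * u s) - (D : ℝ) / 2 * (u (L2 + r) * (get2 E s r : ℝ) * u s) := by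
    intro r _ s hs
    have hs' : s < L2 := by simpa using hs
    rw [if_neg (fun h => by omega), if_pos ⟨by omega, hs'⟩, Nat.add_sub_cancel_left]; push_cast; ring
  have h4 : ∀ r ∈ range L2, ∀ s ∈ range L2,
      u (L2 + r) * ((if L2 + r < L2 ∧ L2 ≤ L2 + s then D / 2 * (get2 E (L2 + s - L2) (L2 + r) - get2 E (L2 + r) (L2 + s - L2))
        else if L2 ≤ L2 + r ∧ L2 + s < L2 then D / 2 * (get2 E (L2 + r - L2) (L2 + s) - get2 E (L2 + s) (L2 + r - L2)) else 0 : ℚ) : ℝ)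
        * u (L2 + s) = 0 := by
    intro r _ s _
    rw [if_neg (fun h => by omega), if_neg (fun h => by omega)]; simp
  rw [Finset.sum_congr rfl fun r hr => Finset.sum_congr rfl fun s hs => h1 r hr s hs,
    Finset.sum_congr rfl fun r hr => Finset.sum_congr rfl fun s hs => h2 r hr s hs,
    Finset.sum_congr rfl fun r hr => Finset.sum_congr rfl fun s hs => h3 r hr s hs,
    Finset.sum_congr rfl fun r hr => Finset.sum_congr rfl fun s hs => h4 r hr s hs]
  simp only [Finset.sum_const_zero, Finset.sum_sub_distrib, ← Finset.mul_sum, zero_add, add_zero]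
  -- reindex the (y, x) block: Σ_r Σ_s y_r E_rs x_s appears once as Σ_r Σ_s u(L2+r) E r s u s and once as Σ_r Σ_s u r E s r u (L2+s)
  rw [Finset.sum_comm (f := fun r s => u r * (get2 E s r : ℝ) * u (L2 + s)),
    Finset.sum_comm (f := fun r s => u (L2 + r) * (get2 E s r : ℝ) * u s)]
  have e1 : ∑ y ∈ range L2, ∑ x ∈ range L2, u x * (get2 E y x : ℝ) * u (L2 + y) = ∑ i ∈ range L2, ∑ j ∈ range L2, u (L2 + i) * (get2 E i j : ℝ) * u j :=
    Finset.sum_congr rfl fun i _ => Finset.sum_congr rfl fun j _ => by ring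
  have e2 : ∑ y ∈ range L2, ∑ x ∈ range L2, u (L2 + x) * (get2 E y x : ℝ) * u y = ∑ i ∈ range L2, ∑ j ∈ range L2, u i * (get2 E i j : ℝ) * u (L2 + j) :=
    Finset.sum_congr rfl fun i _ => Finset.sum_congr rfl fun j _ => by ring
  rw [e1, e2]
  ring

/-- **`ωᵀ Q0_m ω = c¹ᵀQ1c¹ + c²ᵀQ1c²`** with `c = (c¹; c²) = projLin L2 ω` (SPEC 2.8 on the constant piece). -/
theorem qform_q0Piece (N P : ℕ) (A C : ℚ) (ω : ℕ → ℝ) :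
    qform (q0Piece N P A C) (2 * (N + P + 4 - 1)) ω
      = qform (q1Tab N P A C) (N + P + 4) (projLin (N + P + 4) ω)
        + qform (q1Tab N P A C) (N + P + 4) (fun s => projLin (N + P + 4) ω (N + P + 4 + s)) := by
  rw [q0Piece_eq, qform_projTab _ _ (by omega), form_twoDiag]

/-- **`ωᵀ QT_m ω = −(c¹ᵀRc¹ + c²ᵀRc²)`** (SPEC 2.8 on the `T` piece). -/
theorem qform_qtPiece (N P : ℕ) (D : ℚ) (ω : ℕ → ℝ) :
    qform (qtPiece N P D) (2 * (N + P + 4 - 1)) ω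
      = -(qform (rTab N P D) (N + P + 4) (projLin (N + P + 4) ω)
        + qform (rTab N P D) (N + P + 4) (fun s => projLin (N + P + 4) ω (N + P + 4 + s))) := by
  rw [qtPiece_eq, qform_projTab _ _ (by omega), form_twoDiag]
  have h : ∀ v : ℕ → ℝ, qform (matScale (-1) (rTab N P D)) (N + P + 4) v = -qform (rTab N P D) (N + P + 4) v := by
    intro v
    have := qform_of_entry (matScale (-1) (rTab N P D)) (rTab N P D) (rTab N P D) (-1) 0 (N + P + 4) v
      (fun i j => by rw [get2_matScale]; push_cast; ring)
    rw [this]; ring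
  rw [h, h]; ring

/-- **`ωᵀ Qφ_m⁽ᵖ⁾ ω = D·(c²ᵀE⁽ᵖ⁾c¹ − c¹ᵀE⁽ᵖ⁾c²)`** (SPEC 2.8 on the profile pieces; `= −D·X_fin⁽ᵖ⁾`). -/
theorem qform_qphiPiece (N P : ℕ) (D : ℚ) (p : ℕ) (ω : ℕ → ℝ) :
    qform (qphiPiece N P D p) (2 * (N + P + 4 - 1)) ω
      = (D : ℝ) * (bform (eTab N P p) (N + P + 4) (fun s => projLin (N + P + 4) ω (N + P + 4 + s)) (projLin (N + P + 4) ω)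
        - bform (eTab N P p) (N + P + 4) (projLin (N + P + 4) ω) (fun s => projLin (N + P + 4) ω (N + P + 4 + s))) := by
  rw [qphiPiece_eq, qform_projTab _ _ (by omega), form_twoOff]

end Summit.NavierStokesRegularity.TurbBounds.ShearSpecPieces
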